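import Summits.QuantumFields.QCD.Theorems.HeatSlicedQuarksRobustYangMillsHandoverTransferWeightFormMassBounds

/-!
# The Rayleigh quotient of the QCD transfer operator is equicontinuous in the bare masses
(crux `HeatSlicedQuarks.RobustYangMillsHandover`, item stmt-QuantumFields-8892, line `pin-the-infimum`;
helper towards the held stub `stub_spectralResponse`, mechanism step (ii) — file 2b of the series on the continuity
of Lüscher's finite-volume transfer levels in the bare mass)

For `β ≥ 0` and a mass tuple `m₀` in Lüscher's range, the family of functions `m ↦ R_m(Ψ)` (`transferRayleigh`),
indexed by the continuous waves `Ψ ≢ 0`, is EQUICONTINUOUS at `m₀`: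

  `∀ η > 0, ∀ᶠ m → m₀, ∀ Ψ continuous with ∫ Re⟨Ψ,Ψ⟩ ≠ 0, |R_m(Ψ) − R_{m₀}(Ψ)| ≤ η`

(`transferRayleigh_mass_equicontinuous`).  With `N(Ψ) = ∫ Re⟨Ψ(U), Ψ(U)⟩ dU`, the entry-sum closeness
`Σ‖T̂_F(U;m) − T̂_F(U;m₀)‖ ≤ ε`, the entry bound `Σ‖T̂_F(U;m)‖ ≤ B` and the coercivity `c·Re⟨v,v⟩ ≤ Re⟨v,T̂_F v⟩`
give `|𝔫_m − 𝔫_{m₀}| ≤ ε N`, `Re 𝔫 ≥ c N` (file 2a), `|𝔱_m − 𝔱_{m₀}| ≤ 2εB N` (the Wilson kernel is `0 ≤ K ≤ 1`),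
`0 ≤ Re 𝔱_{m₀} ≤ B² N` (this file), whence `|R_m − R_{m₀}| ≤ ε (2B/c + B²/c²)` uniformly in `Ψ`.

References: M. Reed, B. Simon, *Methods of Modern Mathematical Physics IV*, Thm XIII.1 [ReedSimonIV1978];
M. Lüscher, Commun. Math. Phys. 54 (1977) 283 [Luscher1977, pp. 283–292].  Pure theorem file.
-/

noncomputable section

namespace Summit.QuantumFields.QCD.Cruxes.RobustYangMillsHandover.PinTheInfimum

open scoped ComplexOrder ComplexConjugate Topology
open MeasureTheory Matrix Filter Literature.MathematicalPhysics.QuantumFieldTheory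
  Literature.MathematicalPhysics.QuantumLattice
open Summit.QuantumFields.QCD.Cruxes.StableActionBridge.Sketch
open Literature.MathematicalPhysics.QuantumLattice (EigenvalueContinuation.re_star_dotProduct_self_nonneg
  EigenvalueContinuation.norm_apply_sq_le)

namespace TransferMassContinuity

variable {Nf S : ℕ} [NeZero S]

/-! ### Double-integral bounds: the transfer form `𝔱` -/

/-- The `𝔱`-integrand `(U,U') ↦ K_β(U,U') ⟨T̂_F(U;m)Ψ(U), T̂_F(U';m)Ψ(U')⟩` of a continuous wave is jointly continuous.
[folklore] -/
theorem continuous_transfer_integrand (β : ℝ) (m : Fin Nf → ℝ) (hm : ∀ f, -1 < m f) {Ψ : SliceWave Nf S}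
    (hΨ : Continuous Ψ) :
    Continuous fun p : GaugeConfig 3 S (Matrix.specialUnitaryGroup (Fin 3) ℂ) ×
        GaugeConfig 3 S (Matrix.specialUnitaryGroup (Fin 3) ℂ) =>
      (gaugeSliceKernel β p.1 p.2 : ℂ) *
        (star (fermionSliceOp p.1 m *ᵥ Ψ p.1) ⬝ᵥ (fermionSliceOp p.2 m *ᵥ Ψ p.2)) := by
  have hχ : Continuous fun U : GaugeConfig 3 S (Matrix.specialUnitaryGroup (Fin 3) ℂ) =>
      fermionSliceOp U m *ᵥ Ψ U := (continuous_fermionSliceOp Nf S m hm).matrix_mulVec hΨ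
  exact (Complex.continuous_ofReal.comp (continuous_gaugeSliceKernel S β)).mul
    ((hχ.comp continuous_fst).star.dotProduct (hχ.comp continuous_snd))

/-- Fubini input (complex version): for a jointly continuous integrand on the product of two slices, the inner Haar
integral is Haar integrable in the outer variable. [folklore] -/
theorem integrable_inner_integral_sliceHaar_complex
    {F : GaugeConfig 3 S (Matrix.specialUnitaryGroup (Fin 3) ℂ) × GaugeConfig 3 S (Matrix.specialUnitaryGroup (Fin 3) ℂ) → ℂ}
    (hF : Continuous F) :
    Integrable (fun U => ∫ U', F (U, U') ∂(sliceHaar S)) (sliceHaar S) := by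
  haveI := isProbabilityMeasure_sliceHaar S
  obtain ⟨C, hC⟩ := isCompact_univ.exists_bound_of_continuousOn hF.continuousOn
  have hI : Integrable F ((sliceHaar S).prod (sliceHaar S)) :=
    Integrable.of_bound hF.measurable.aestronglyMeasurable C
      (Filter.Eventually.of_forall fun p => hC p (Set.mem_univ p))
  exact hI.integral_prod_left

/-- The algebraic identity behind the difference of two transfer forms:
`⟨Au, Aw⟩ − ⟨Bu, Bw⟩ = ⟨(A − B)u, Aw⟩ + ⟨Bu, (A − B)w⟩`. [folklore] -/
theorem dotProduct_mulVec_sub_identity {ι : Type*} [Fintype ι] (A B : Matrix ι ι ℂ) (u w : ι → ℂ) :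
    star (A *ᵥ u) ⬝ᵥ (A *ᵥ w) - star (B *ᵥ u) ⬝ᵥ (B *ᵥ w) =
      star ((A - B) *ᵥ u) ⬝ᵥ (A *ᵥ w) + star (B *ᵥ u) ⬝ᵥ ((A - B) *ᵥ w) := by
  rw [Matrix.sub_mulVec, Matrix.sub_mulVec, star_sub, sub_dotProduct, dotProduct_sub]
  ring

/-- **`|𝔱_m(Ψ,Ψ) − 𝔱_{m₀}(Ψ,Ψ)| ≤ 2εB ∫ Re⟨Ψ,Ψ⟩`** for `β ≥ 0` (`0 ≤ K_β ≤ 1`), when `Σ‖T̂_F(U;m) − T̂_F(U;m₀)‖ ≤ ε` and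
`Σ‖T̂_F(U;m)‖, Σ‖T̂_F(U;m₀)‖ ≤ B` for all `U`. [folklore] -/
theorem transferForm_sub_norm_le {β : ℝ} (hβ : 0 ≤ β) {m m₀ : Fin Nf → ℝ} (hm : ∀ f, -1 < m f)
    (hm₀ : ∀ f, -1 < m₀ f) {ε B : ℝ} (hε : 0 ≤ ε) (hB : 0 ≤ B)
    (hΔ : ∀ U : GaugeConfig 3 S (Matrix.specialUnitaryGroup (Fin 3) ℂ),
      ∑ s, ∑ t, ‖fermionSliceOp U m s t - fermionSliceOp U m₀ s t‖ ≤ ε)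
    (hBm : ∀ U : GaugeConfig 3 S (Matrix.specialUnitaryGroup (Fin 3) ℂ), ∑ s, ∑ t, ‖fermionSliceOp U m s t‖ ≤ B)
    (hB₀ : ∀ U : GaugeConfig 3 S (Matrix.specialUnitaryGroup (Fin 3) ℂ), ∑ s, ∑ t, ‖fermionSliceOp U m₀ s t‖ ≤ B)
    {Ψ : SliceWave Nf S} (hΨ : Continuous Ψ) :
    ‖transferForm β m Ψ Ψ - transferForm β m₀ Ψ Ψ‖ ≤ 2 * ε * B * ∫ U, (star (Ψ U) ⬝ᵥ Ψ U).re ∂(sliceHaar S) := by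
  haveI := isProbabilityMeasure_sliceHaar S
  -- the two integrands and the diagonal weight
  set Fm : GaugeConfig 3 S (Matrix.specialUnitaryGroup (Fin 3) ℂ) × GaugeConfig 3 S (Matrix.specialUnitaryGroup (Fin 3) ℂ) → ℂ :=
    fun p => (gaugeSliceKernel β p.1 p.2 : ℂ) *
      (star (fermionSliceOp p.1 m *ᵥ Ψ p.1) ⬝ᵥ (fermionSliceOp p.2 m *ᵥ Ψ p.2)) with hFm
  set F₀ : GaugeConfig 3 S (Matrix.specialUnitaryGroup (Fin 3) ℂ) × GaugeConfig 3 S (Matrix.specialUnitaryGroup (Fin 3) ℂ) → ℂ :=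
    fun p => (gaugeSliceKernel β p.1 p.2 : ℂ) *
      (star (fermionSliceOp p.1 m₀ *ᵥ Ψ p.1) ⬝ᵥ (fermionSliceOp p.2 m₀ *ᵥ Ψ p.2)) with hF₀
  set a : GaugeConfig 3 S (Matrix.specialUnitaryGroup (Fin 3) ℂ) → ℝ := fun U => (star (Ψ U) ⬝ᵥ Ψ U).re with ha
  have hFm_cont : Continuous Fm := continuous_transfer_integrand β m hm hΨ
  have hF₀_cont : Continuous F₀ := continuous_transfer_integrand β m₀ hm₀ hΨ
  have ha_cont : Continuous a := continuous_re_star_dotProduct_self hΨ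
  have ha_int : Integrable a (sliceHaar S) := by
    have h := integrable_sliceHaar_of_continuous (Complex.continuous_ofReal.comp ha_cont)
    exact h.re.congr (Eventually.of_forall fun U => by simp [ha])
  set A : ℝ := ∫ U, a U ∂(sliceHaar S) with hA
  -- pointwise bound on the difference of the integrands
  have hpt : ∀ U U', ‖Fm (U, U') - F₀ (U, U')‖ ≤ ε * B * (a U + a U') := by
    intro U U'
    have hK0 : 0 ≤ gaugeSliceKernel β U U' := (gaugeSliceKernel_pos β U U').le
    have hK1 : gaugeSliceKernel β U U' ≤ 1 := gaugeSliceKernel_le_one S β hβ U U'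
    -- direct expansion (robust): rewrite the difference by hand
    have e' : Fm (U, U') - F₀ (U, U') = (gaugeSliceKernel β U U' : ℂ) *
        (star ((fermionSliceOp U m - fermionSliceOp U m₀) *ᵥ Ψ U) ⬝ᵥ (fermionSliceOp U' m *ᵥ Ψ U') +
          star (fermionSliceOp U m₀ *ᵥ Ψ U) ⬝ᵥ ((fermionSliceOp U' m - fermionSliceOp U' m₀) *ᵥ Ψ U')) := by
      simp only [hFm, hF₀]
      rw [← mul_sub, Matrix.sub_mulVec, Matrix.sub_mulVec, star_sub, sub_dotProduct, dotProduct_sub]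
      ring
    rw [e', norm_mul, Complex.norm_real, Real.norm_of_nonneg hK0]
    have h1 := norm_dotProduct_mulVec_mulVec_le (fermionSliceOp U m - fermionSliceOp U m₀) (fermionSliceOp U' m)
      (Ψ U) (Ψ U')
    have h2 := norm_dotProduct_mulVec_mulVec_le (fermionSliceOp U m₀) (fermionSliceOp U' m - fermionSliceOp U' m₀)
      (Ψ U) (Ψ U')
    rw [entrySum_sub] at h1 h2
    have haU : 0 ≤ a U := EigenvalueContinuation.re_star_dotProduct_self_nonneg _
    have haU' : 0 ≤ a U' := EigenvalueContinuation.re_star_dotProduct_self_nonneg _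
    have hsum : ‖star ((fermionSliceOp U m - fermionSliceOp U m₀) *ᵥ Ψ U) ⬝ᵥ (fermionSliceOp U' m *ᵥ Ψ U') +
        star (fermionSliceOp U m₀ *ᵥ Ψ U) ⬝ᵥ ((fermionSliceOp U' m - fermionSliceOp U' m₀) *ᵥ Ψ U')‖ ≤
        ε * B * ((a U + a U') / 2) + B * ε * ((a U + a U') / 2) := by
      refine (norm_add_le _ _).trans (add_le_add (h1.trans ?_) (h2.trans ?_))
      · exact mul_le_mul (mul_le_mul (hΔ U) (hBm U') (Finset.sum_nonneg fun s _ =>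
          Finset.sum_nonneg fun t _ => norm_nonneg _) hε) le_rfl (by positivity) (mul_nonneg hε hB)
      · exact mul_le_mul (mul_le_mul (hB₀ U) (hΔ U') (Finset.sum_nonneg fun s _ =>
          Finset.sum_nonneg fun t _ => norm_nonneg _) hB) le_rfl (by positivity) (mul_nonneg hB hε)
    calc gaugeSliceKernel β U U' * ‖star ((fermionSliceOp U m - fermionSliceOp U m₀) *ᵥ Ψ U) ⬝ᵥ
            (fermionSliceOp U' m *ᵥ Ψ U') +
          star (fermionSliceOp U m₀ *ᵥ Ψ U) ⬝ᵥ ((fermionSliceOp U' m - fermionSliceOp U' m₀) *ᵥ Ψ U')‖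
        ≤ 1 * (ε * B * ((a U + a U') / 2) + B * ε * ((a U + a U') / 2)) :=
          mul_le_mul hK1 hsum (norm_nonneg _) zero_le_one
      _ = ε * B * (a U + a U') := by ring
  -- the difference of the forms as an iterated integral of the difference
  have hinner_m : ∀ U, Integrable (fun U' => Fm (U, U')) (sliceHaar S) := fun U =>
    integrable_sliceHaar_of_continuous (hFm_cont.comp (Continuous.prodMk_right U))
  have hinner_0 : ∀ U, Integrable (fun U' => F₀ (U, U')) (sliceHaar S) := fun U =>
    integrable_sliceHaar_of_continuous (hF₀_cont.comp (Continuous.prodMk_right U))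
  have hdiff : transferForm β m Ψ Ψ - transferForm β m₀ Ψ Ψ =
      ∫ U, ∫ U', (Fm (U, U') - F₀ (U, U')) ∂(sliceHaar S) ∂(sliceHaar S) := by
    unfold transferForm
    rw [← integral_sub (integrable_inner_integral_sliceHaar_complex hFm_cont)
      (integrable_inner_integral_sliceHaar_complex hF₀_cont)]
    refine integral_congr_ae (Eventually.of_forall fun U => ?_)
    simp only [hFm, hF₀]
    rw [← integral_sub (hinner_m U) (hinner_0 U)]
  rw [hdiff]
  -- bound the iterated integral
  have hbound_inner : ∀ U, ‖∫ U', (Fm (U, U') - F₀ (U, U')) ∂(sliceHaar S)‖ ≤ ε * B * (a U + A) := by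
    intro U
    have hb : Integrable (fun U' => ε * B * (a U + a U')) (sliceHaar S) :=
      ((integrable_const (a U)).add ha_int).const_mul (ε * B)
    calc ‖∫ U', (Fm (U, U') - F₀ (U, U')) ∂(sliceHaar S)‖ ≤ ∫ U', ε * B * (a U + a U') ∂(sliceHaar S) :=
          norm_integral_le_of_norm_le hb (Eventually.of_forall (hpt U))
      _ = ε * B * (a U + A) := by
          rw [integral_const_mul, integral_add (integrable_const _) ha_int, integral_const, probReal_univ, one_smul]
  have hb2 : Integrable (fun U => ε * B * (a U + A)) (sliceHaar S) := (ha_int.add (integrable_const A)).const_mul (ε * B)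
  calc ‖∫ U, ∫ U', (Fm (U, U') - F₀ (U, U')) ∂(sliceHaar S) ∂(sliceHaar S)‖
      ≤ ∫ U, ε * B * (a U + A) ∂(sliceHaar S) := norm_integral_le_of_norm_le hb2 (Eventually.of_forall hbound_inner)
    _ = ε * B * (A + A) := by
        rw [integral_const_mul, integral_add ha_int (integrable_const _), integral_const, probReal_univ, one_smul]
    _ = 2 * ε * B * A := by ring

/-- **`Re 𝔱_m(Ψ,Ψ) ≤ B² ∫ Re⟨Ψ,Ψ⟩`** for `β ≥ 0` when `Σ‖T̂_F(U;m)‖ ≤ B` for all `U` (the sub-unit positive Wilson kernel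
is dominated by the diagonal, `re_double_integral_kernel_dotProduct_le`, and `‖T̂_F Ψ‖₂² ≤ S(T̂_F)² Re⟨Ψ,Ψ⟩`). [folklore] -/
theorem transferForm_re_le {β : ℝ} (hβ : 0 ≤ β) {m : Fin Nf → ℝ} (hm : ∀ f, -1 < m f) {B : ℝ}
    (hBm : ∀ U : GaugeConfig 3 S (Matrix.specialUnitaryGroup (Fin 3) ℂ), ∑ s, ∑ t, ‖fermionSliceOp U m s t‖ ≤ B)
    {Ψ : SliceWave Nf S} (hΨ : Continuous Ψ) :
    (transferForm β m Ψ Ψ).re ≤ B ^ 2 * ∫ U, (star (Ψ U) ⬝ᵥ Ψ U).re ∂(sliceHaar S) := by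
  haveI := isProbabilityMeasure_sliceHaar S
  have hχc : Continuous fun U : GaugeConfig 3 S (Matrix.specialUnitaryGroup (Fin 3) ℂ) => fermionSliceOp U m *ᵥ Ψ U :=
    (continuous_fermionSliceOp Nf S m hm).matrix_mulVec hΨ
  obtain ⟨C, hC⟩ := exists_bound_of_continuous_slice (S := S) hχc
  have hχb : ∃ C : ℝ, ∀ (U : GaugeConfig 3 S (Matrix.specialUnitaryGroup (Fin 3) ℂ)) (i : Finset (SliceFermiIdx Nf S)),
      ‖(fermionSliceOp U m *ᵥ Ψ U) i‖ ≤ C :=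
    ⟨C, fun U i => (norm_le_pi_norm _ i).trans (hC U)⟩
  have hχm : ∀ i : Finset (SliceFermiIdx Nf S), Measurable fun U : GaugeConfig 3 S (Matrix.specialUnitaryGroup (Fin 3) ℂ) =>
      (fermionSliceOp U m *ᵥ Ψ U) i := fun i => ((continuous_apply i).comp hχc).measurable
  have hK := re_double_integral_kernel_dotProduct_le (GaugeConfig 3 S (Matrix.specialUnitaryGroup (Fin 3) ℂ)) (sliceHaar S)
    (Finset (SliceFermiIdx Nf S)) (gaugeSliceKernel β) (fun U => fermionSliceOp U m *ᵥ Ψ U)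
    (fun U U' => (gaugeSliceKernel_pos β U U').le) (gaugeSliceKernel_le_one S β hβ)
    (continuous_gaugeSliceKernel S β).measurable hχb hχm
  unfold transferForm
  refine hK.trans ?_
  rw [← integral_const_mul]
  refine integral_mono ?_ ?_ fun U => ?_
  · exact (integrable_sliceHaar_of_continuous (hχc.star.dotProduct hχc)).re
  · have h := integrable_sliceHaar_of_continuous (Complex.continuous_ofReal.comp (continuous_re_star_dotProduct_self hΨ))
    exact (h.re.const_mul (B ^ 2)).congr (Eventually.of_forall fun U => by simp)
  · show (star (fermionSliceOp U m *ᵥ Ψ U) ⬝ᵥ (fermionSliceOp U m *ᵥ Ψ U)).re ≤ B ^ 2 * (star (Ψ U) ⬝ᵥ Ψ U).re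
    rw [PosSemidefRayleigh.re_star_dotProduct_self]
    refine (sum_norm_mulVec_sq_le _ _).trans (mul_le_mul_of_nonneg_right ?_ (EigenvalueContinuation.re_star_dotProduct_self_nonneg _))
    have h0 : 0 ≤ ∑ s, ∑ t, ‖fermionSliceOp U m s t‖ := Finset.sum_nonneg fun s _ => Finset.sum_nonneg fun t _ => norm_nonneg _
    exact pow_le_pow_left₀ h0 (hBm U) 2

/-! ### Equicontinuity of the Rayleigh quotient in the masses -/

/-- **The Rayleigh quotient is equicontinuous in the bare masses**: for `β ≥ 0`, `m₀` in Lüscher's range and `η > 0`,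
eventually as `m → m₀` within the range, `|R_m(Ψ) − R_{m₀}(Ψ)| ≤ η` for EVERY continuous wave `Ψ` with
`∫ Re⟨Ψ,Ψ⟩ ≠ 0` — the modulus does not depend on `Ψ`. [cite: ReedSimonIV1978, Thm XIII.1] [cite: Luscher1977, pp. 283–292] -/
theorem transferRayleigh_mass_equicontinuous {β : ℝ} (hβ : 0 ≤ β) (m₀ : {m : Fin Nf → ℝ // ∀ f, -1 < m f})
    {η : ℝ} (hη : 0 < η) :
    ∀ᶠ m in 𝓝 m₀, ∀ Ψ : SliceWave Nf S, Continuous Ψ → (∫ U, (star (Ψ U) ⬝ᵥ Ψ U).re ∂(sliceHaar S)) ≠ 0 →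
      |transferRayleigh β m.1 Ψ - transferRayleigh β m₀.1 Ψ| ≤ η := by
  obtain ⟨c, hc, hco_ev⟩ := fermionSliceOp_coercive_near (Nf := Nf) (S := S) m₀
  obtain ⟨B, hB, hB_ev⟩ := fermionSliceOp_entrySum_le_near (Nf := Nf) (S := S) m₀
  have hB₀ := hB_ev.self_of_nhds
  have hco₀ := hco_ev.self_of_nhds
  set L : ℝ := 2 * B / c + B ^ 2 / c ^ 2 with hL
  have hL0 : 0 ≤ L := by positivity
  set ε : ℝ := η / (L + 1) with hεdef
  have hε : 0 < ε := div_pos hη (by linarith)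
  filter_upwards [hco_ev, hB_ev, fermionSliceOp_entrySum_sub_small (S := S) m₀ hε] with m hco hBm hΔ Ψ hΨ hN
  have hN0 := integral_re_star_dotProduct_self_nonneg (S := S) Ψ
  have hNpos : 0 < ∫ U, (star (Ψ U) ⬝ᵥ Ψ U).re ∂(sliceHaar S) := lt_of_le_of_ne hN0 (Ne.symm hN)
  have hm : ∀ f, -1 < m.1 f := m.2
  have hm₀ : ∀ f, -1 < m₀.1 f := m₀.2
  -- the four estimates
  have hn : c * ∫ U, (star (Ψ U) ⬝ᵥ Ψ U).re ∂(sliceHaar S) ≤ (fermionWeightForm m.1 Ψ Ψ).re :=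
    fermionWeightForm_re_ge hm hco hΨ
  have hn₀ : c * ∫ U, (star (Ψ U) ⬝ᵥ Ψ U).re ∂(sliceHaar S) ≤ (fermionWeightForm m₀.1 Ψ Ψ).re :=
    fermionWeightForm_re_ge hm₀ hco₀ hΨ
  have hnn : |(fermionWeightForm m.1 Ψ Ψ).re - (fermionWeightForm m₀.1 Ψ Ψ).re| ≤
      ε * ∫ U, (star (Ψ U) ⬝ᵥ Ψ U).re ∂(sliceHaar S) := by
    rw [← Complex.sub_re]
    exact (Complex.abs_re_le_norm _).trans (fermionWeightForm_sub_norm_le hm hm₀ hΔ hΨ)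
  have htt : |(transferForm β m.1 Ψ Ψ).re - (transferForm β m₀.1 Ψ Ψ).re| ≤
      2 * ε * B * ∫ U, (star (Ψ U) ⬝ᵥ Ψ U).re ∂(sliceHaar S) := by
    rw [← Complex.sub_re]
    exact (Complex.abs_re_le_norm _).trans (transferForm_sub_norm_le hβ hm hm₀ hε.le hB.le hΔ hBm hB₀ hΨ)
  have ht₀0 : 0 ≤ (transferForm β m₀.1 Ψ Ψ).re := (transferForm_self_nonneg Nf S β m₀.1 hβ hm₀ Ψ hΨ).1
  have ht₀ : (transferForm β m₀.1 Ψ Ψ).re ≤ B ^ 2 * ∫ U, (star (Ψ U) ⬝ᵥ Ψ U).re ∂(sliceHaar S) :=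
    transferForm_re_le hβ hm₀ hB₀ hΨ
  have key := abs_div_sub_div_le hc hNpos hε.le hB.le hn hn₀ hnn htt ht₀0 ht₀
  unfold transferRayleigh
  refine key.trans ?_
  rw [hεdef, ← hL, div_mul_eq_mul_div, div_le_iff₀ (by linarith)]
  nlinarith [hL0, hη]

end TransferMassContinuity

/-- **Equicontinuity of the Rayleigh quotient of the QCD transfer operator in the bare masses** (registered sub-goal
`transferRayleigh_mass_equicontinuous` of crux stmt-QuantumFields-8892, line `pin-the-infimum`; statement-level export):
for `β ≥ 0`, every `m₀` in Lüscher's range and `η > 0`, eventually as `m → m₀` within the range,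
`|R_m(Ψ) − R_{m₀}(Ψ)| ≤ η` for every continuous wave `Ψ` with `∫ Re⟨Ψ,Ψ⟩ ≠ 0`.
[cite: ReedSimonIV1978, Thm XIII.1] [cite: Luscher1977, pp. 283–292] -/
theorem transferRayleigh_mass_equicontinuous : ∀ (Nf S : ℕ) [NeZero S] (β : ℝ), 0 ≤ β → ∀ (m₀ : {m : Fin Nf → ℝ // ∀ f, -1 < m f}) (η : ℝ), 0 < η → ∀ᶠ m in 𝓝 m₀, ∀ Ψ : SliceWave Nf S, Continuous Ψ → (∫ U, (star (Ψ U) ⬝ᵥ Ψ U).re ∂(sliceHaar S)) ≠ 0 → |transferRayleigh β m.1 Ψ - transferRayleigh β m₀.1 Ψ| ≤ η :=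
  fun _ _ _ _ hβ m₀ _ hη => TransferMassContinuity.transferRayleigh_mass_equicontinuous hβ m₀ hη

end Summit.QuantumFields.QCD.Cruxes.RobustYangMillsHandover.PinTheInfimum

end
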